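import Summits.BirchSwinnertonDyer.Rank1Residual.X11b.PoitouTateSelmerCounting
import Literature.NumberTheory.EllipticCurves.LocalEulerCharacteristicTorsion
import Summits.BirchSwinnertonDyer.Rank1Residual.GaloisImage.LocalEulerPoincareCharacteristicHolds
import HarnessLib

/-!
# Crux `PrintCf2.SplitBadTwoRankOneOfFacts` (stmt-BirchSwinnertonDyer-20368), road α v10.3, S3c input (F3), piece (P2):
# the Poitou–Tate COUNT at one relaxed place and the local Euler–Poincaré count, generic

Cell `bsd-print-cf2`, EXTRA WIDTH seat `bsd-line-cf2-p1-w4` g9 (prover-bsd-line-cf2-p1-w4-g9-0); `--supports stmt-BirchSwinnertonDyer-20368`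
(helper, Theses-free). HONEST FRAMING: nothing here closes the crux or a registered stub; BSD is not proved by any of this; no summit
statement is proved by this seat. No definition, no named fact, no `sorry`. Piece (P2) of -w5 g3's plan `Cruxes/SplitBadTwoRankOneOfFacts/F3-PLAN-w5g3.md`
(§2) for the (F3) input «`v₂ #loc_v(𝔖_{v̄}(K, W*)) = ℓ + e₃([d]₂)`» of cut 12 (p674084): the two counting identities it needs, with NO elliptic curve
and NO complex multiplication in them.

SETTING. `K` a number field, `M` a finite discrete `Γ_K`-module killed by `n`, `inv` a family of local invariant maps with `IsPerfect`,
`SumLocalTermEqZero`, `SelmerComplement` (the named fact `poitouTate_selmerStructure_duality K` provides one), `S ⊇ {v ∣ ∞} ∪ {v ∣ n} ∪ Ram(M)`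
finite, `𝓕 ≤ 𝓖` Selmer structures on `M` unramified outside `S` that DIFFER ONLY AT ONE FINITE PLACE `w₀ ∈ S`, WHERE `𝓖` IS RELAXED
(`𝓖_{w₀} = H¹(K_{w₀}, M)`).

WHAT.
* §1 `relIndex_dualSelmerGroup_eq_natCard_map_localization` (P2b): `[H¹_{𝓕*}(K, M^D) : H¹_{𝓖*}(K, M^D)] = #loc_{w₀}(H¹_{𝓕*}(K, M^D))`
  (`𝓖*_{w₀} = H¹(K_{w₀}, M)^⊥ = 0` by local Tate duality `IsPerfect`, so `H¹_{𝓖*} = H¹_{𝓕*} ∩ ker loc_{w₀}`).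
* §1 `relIndex_selmerGroup_mul_natCard_map_localization_mul_natCard_eq` (P2a·b): X11b's one-place counting form of Poitou–Tate
  (`PoitouTateCounting.relIndex_selmerGroup_mul_relIndex_dual_eq`, Howard Thm. 2.1.11 / JSW17 Prop. 3.2.1) in the relaxed case:
  **`[H¹_𝓖(K, M) : H¹_𝓕(K, M)] · #loc_{w₀}(H¹_{𝓕*}(K, M^D)) · #𝓕_{w₀} = #H¹(K_{w₀}, M)`.**
* §2 `natCard_galoisCohomology_one_toLocal_eq` (P2c): for `M` killed by `p^k`, **`#H¹(K_w, M) = #M^{Γ_{K_w}} · #Hom_{Γ_{K_w}}(M, μ_{p^k}) · #(𝓞_w ⧸ (#M))`**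
  — Tate's local Euler–Poincaré characteristic (Milne I Thm. 2.8), whose named fact `localEulerPoincareCharacteristic (K_w)` is PROVED in the tree
  (`localEulerPoincareCharacteristic_holds`) and is discharged here, with local duality in bidegree `(2,0)` (tree
  `natCard_two_eq_natCard_invariants_homRep`, Milne I Cor. 2.3) for the `H²` term.
* §3 `relIndex_selmerGroup_mul_natCard_map_localization_mul_natCard_eq_localEuler` (P2): the two combined —
  **`[H¹_𝓖 : H¹_𝓕] · #loc_{w₀}(H¹_{𝓕*}(K, M^D)) · #𝓕_{w₀} = #M^{Γ_{K_{w₀}}} · #Hom_{Γ_{K_{w₀}}}(M, μ_{p^k}) · #(𝓞_{w₀} ⧸ (#M))`.**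
USE ((F3), -w5 g3 (P1)/(P3)): `M = W*[2^k]`, `w₀ = v`, `𝓕_v = N_v = δ_v(W*(K_v))`, `𝓖_v = everything`; `[H¹_𝓖 : H¹_𝓕] = #loc_v(𝔖_{v̄}(K, W*))` is (P1),
`#loc_v(H¹_{𝓕*})` is the `π^k`-descent side (P3), `K_v = ℚ₂` gives `#(𝓞_v ⧸ 2^k) = 2^k`.
presearch: Howard 2004 Thm. 2.1.11 / Milne ADT I Thm. 4.10, Thm. 2.8, Cor. 2.3 → all three are TREE THEOREMS over the named PT family
([tree: X11b PoitouTateSelmerCounting, LocalEulerCharacteristicTorsion, LocalDualityTwoZero, GaloisImage.LocalEulerPoincareCharacteristicHolds]); no new fact.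
beyond-print theorem: no.

References: [Howard2004HeegnerKolyvagin] Thm. 2.1.11; [JetchevSkinnerWan2017] Prop. 3.2.1 (proof); [MilneADT2006] I Cor. 2.3, Thm. 2.8, Thm. 4.10;
[SerreGaloisCohomology1997] II §5.2 Thm. 2, §5.7 Thm. 5.
-/

noncomputable section

open scoped Classical

set_option linter.dupNamespace false
set_option autoImplicit false

open Function NumberField IsDedekindDomain
open Literature.NumberTheory.GaloisRepresentations
open Literature.NumberTheory.GaloisRepresentations.DiscreteGaloisModule (localTatePairingZMod tateDual SelmerStructure mu)
open Literature.NumberTheory.GaloisCohomology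
open Literature.NumberTheory.GaloisCohomology.LocalInvariants
open Summit.BirchSwinnertonDyer.Rank1Residual.X11b

universe u

namespace Summit.BirchSwinnertonDyer.BirchSwinnertonDyer.Theorems.PrintCf2.RestrictedSelmerPair

/-! ## §1. Poitou–Tate at one RELAXED place: `[H¹_𝓖 : H¹_𝓕] · #loc_{w₀}(H¹_{𝓕*}) · #𝓕_{w₀} = #H¹(K_{w₀}, M)` -/

section OnePlace

variable {K : Type u} [Field K] [NumberField K] {n : ℕ} {M : Type u} [AddCommGroup M] [TopologicalSpace M] [DiscreteTopology M]
  [Finite M] {inv : LocalInvariants K n} {ρ : DiscreteGaloisModule K M} {S : Finset (Place K)} {𝓕 𝓖 : SelmerStructure ρ}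
  {w₀ : HeightOneSpectrum (𝓞 K)}

/-- **(P2b) `[H¹_{𝓕*}(K, M^D) : H¹_{𝓖*}(K, M^D)] = #loc_{w₀}(H¹_{𝓕*}(K, M^D))`** when `𝓕 ≤ 𝓖` agree away from the finite place `w₀` and
`𝓖_{w₀} = H¹(K_{w₀}, M)`: the dual structures agree away from `w₀` and `𝓖*_{w₀} = (H¹(K_{w₀}, M))^⊥ = 0` by local Tate duality
(`IsPerfect`), so `H¹_{𝓖*} = H¹_{𝓕*} ∩ ker loc_{w₀}` and the index is the order of the image (X11b `relIndex_selmerGroup_eq`).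
[cite: Howard2004HeegnerKolyvagin, Def. 2.1.6 and Thm. 2.1.11 (arXiv:1202.6340 pp. 5–6)] [cite: MilneADT2006, I Cor. 2.3] -/
theorem relIndex_dualSelmerGroup_eq_natCard_map_localization [NeZero n] (hperf : inv.IsPerfect) (hM : ∀ m : M, n • m = 0)
    (hle : 𝓕 ≤ 𝓖) (heq : ∀ v ≠ (Sum.inr w₀ : Place K), 𝓕 v = 𝓖 v) (htop : 𝓖 (Sum.inr w₀) = ⊤) :
    (inv.dualSelmerStructure ρ 𝓖).selmerGroup.relIndex (inv.dualSelmerStructure ρ 𝓕).selmerGroup =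
      Nat.card ((inv.dualSelmerStructure ρ 𝓕).selmerGroup.map
        (galoisCohomology.localization (ρ.tateDual n) (Sum.inr w₀ : Place K) 1)) := by
  have hle' : inv.dualSelmerStructure ρ 𝓖 ≤ inv.dualSelmerStructure ρ 𝓕 := inv.dualSelmerStructure_anti ρ hle
  have heq' : ∀ v ≠ (Sum.inr w₀ : Place K), inv.dualSelmerStructure ρ 𝓖 v = inv.dualSelmerStructure ρ 𝓕 v :=
    fun v hv ↦ by rw [dualSelmerStructure_apply, dualSelmerStructure_apply, heq v hv]
  rw [PoitouTateCounting.relIndex_selmerGroup_eq hle' heq', dualSelmerStructure_apply, htop,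
    PoitouTateCounting.dualLocalCondition_top hperf ρ hM w₀, sup_bot_eq, AddSubgroup.relIndex_bot_left]

/-- **(P2a·b) Poitou–Tate at one relaxed place, counting form: `[H¹_𝓖(K, M) : H¹_𝓕(K, M)] · #loc_{w₀}(H¹_{𝓕*}(K, M^D)) · #𝓕_{w₀} = #H¹(K_{w₀}, M)`**
for Selmer structures `𝓕 ≤ 𝓖` unramified outside `S ⊇ {v ∣ ∞} ∪ {v ∣ n} ∪ Ram(M)`, agreeing away from the finite place `w₀ ∈ S`, with
`𝓖_{w₀} = H¹(K_{w₀}, M)` (X11b `PoitouTateCounting.relIndex_selmerGroup_mul_relIndex_dual_eq` = Howard Thm. 2.1.11 counted, JSW17 Prop. 3.2.1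
«`#im(α) = #coker(β)`», with `[H¹(K_{w₀}, M) : 𝓕_{w₀}] · #𝓕_{w₀} = #H¹(K_{w₀}, M)` and §1 (P2b)).
[cite: JetchevSkinnerWan2017, Prop. 3.2.1 proof (arXiv:1512.06894 p. 10)] [cite: Howard2004HeegnerKolyvagin, Thm. 2.1.11 (arXiv:1202.6340 p. 6)]
[cite: MilneADT2006, I Thm. 4.10] -/
theorem relIndex_selmerGroup_mul_natCard_map_localization_mul_natCard_eq [NeZero n] (hperf : inv.IsPerfect)
    (hvan : inv.SumLocalTermEqZero) (hcomp : inv.SelmerComplement) (hM : ∀ m : M, n • m = 0)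
    (hS : ∀ v : HeightOneSpectrum (𝓞 K), (Sum.inr v : Place K) ∉ S → ((n : ℕ) : 𝓞 K) ∉ v.asIdeal ∧ GaloisRep.IsUnramifiedAt v ρ)
    (hle : 𝓕 ≤ 𝓖) (h𝓕 : 𝓕.IsUnramifiedOutside S) (h𝓖 : 𝓖.IsUnramifiedOutside S) (hw₀ : (Sum.inr w₀ : Place K) ∈ S)
    (heq : ∀ v ≠ (Sum.inr w₀ : Place K), 𝓕 v = 𝓖 v) (htop : 𝓖 (Sum.inr w₀) = ⊤) :
    𝓕.selmerGroup.relIndex 𝓖.selmerGroup *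
        Nat.card ((inv.dualSelmerStructure ρ 𝓕).selmerGroup.map
          (galoisCohomology.localization (ρ.tateDual n) (Sum.inr w₀ : Place K) 1)) *
        Nat.card (𝓕 (Sum.inr w₀)) = Nat.card (galoisCohomology (ρ.toLocal (Sum.inr w₀)) 1) := by
  have h := PoitouTateCounting.relIndex_selmerGroup_mul_relIndex_dual_eq hperf hvan hcomp hM hS hle h𝓕 h𝓖 hw₀ heq
  rw [relIndex_dualSelmerGroup_eq_natCard_map_localization hperf hM hle heq htop, htop, AddSubgroup.relIndex_top_right] at h
  rw [h, AddSubgroup.index_mul_card]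

end OnePlace

/-! ## §2. The local Euler–Poincaré count `#H¹(K_w, M) = #M^{Γ_{K_w}} · #Hom_{Γ_{K_w}}(M, μ_{p^k}) · #(𝓞_w ⧸ #M)` -/

section Local

variable {K : Type u} [Field K] [NumberField K] {M : Type u} [AddCommGroup M] [TopologicalSpace M] [DiscreteTopology M] [Finite M]

/-- **Milne I Thm. 2.8 at `K_w`** — the named fact `localEulerPoincareCharacteristic (w.adicCompletion K)` DISCHARGED by the tree's proof
`localEulerPoincareCharacteristic_holds` (Tate's local Euler–Poincaré characteristic formula for local fields of characteristic `0`).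
[cite: MilneADT2006, I §2 Thm. 2.8 (p. 31)] [cite: SerreGaloisCohomology1997, II §5.7 Thm. 5] -/
theorem localEulerPoincareCharacteristic_adicCompletion_of_numberField (w : HeightOneSpectrum (𝓞 K)) :
    localEulerPoincareCharacteristic (w.adicCompletion K) := by
  haveI : CharZero (w.adicCompletion K) := charZero_of_injective_algebraMap (algebraMap K (w.adicCompletion K)).injective
  exact localEulerPoincareCharacteristic_holds _

/-- **(P2c) `#H¹(K_w, M) = #M^{Γ_{K_w}} · #Hom_{Γ_{K_w}}(M, μ_{p^k}) · #(𝓞_w ⧸ (#M)𝓞_w)`** for a finite discrete `Γ_K`-module `M` killed by `p^k` and a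
finite place `w`: Tate's local Euler–Poincaré characteristic `#H⁰ · #H² · #(𝓞_w ⧸ #M) = #H¹` (Milne I Thm. 2.8, PROVED in the tree) with
`#H²(K_w, M) = #Hom_{Γ_{K_w}}(M, μ_{p^k})` (local duality in bidegree `(2,0)`, Milne I Cor. 2.3, tree `natCard_two_eq_natCard_invariants_homRep`).
[cite: MilneADT2006, I §2 Thm. 2.8 and Cor. 2.3] [cite: SerreGaloisCohomology1997, II §5.2 Thm. 2] -/
theorem natCard_galoisCohomology_one_toLocal_eq (ρ : DiscreteGaloisModule K M) {p : ℕ} [Fact p.Prime] {k : ℕ}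
    (hM : ∀ m : M, p ^ k • m = 0) (w : HeightOneSpectrum (𝓞 K)) :
    Nat.card (galoisCohomology (ρ.toLocal (Sum.inr w)) 1) =
      Nat.card (GaloisRep.restrictField (w.adicCompletion K) ρ).toTopRep.ρ.invariants *
        Nat.card (ContinuousRep.homRep (GaloisRep.restrictField (w.adicCompletion K) ρ)
          (mu (w.adicCompletion K) (p ^ k))).toTopRep.ρ.invariants *
        Nat.card (w.adicCompletionIntegers K ⧸ Ideal.span {((Nat.card M : ℕ) : w.adicCompletionIntegers K)}) := by
  haveI : CharZero (w.adicCompletion K) := charZero_of_injective_algebraMap (algebraMap K (w.adicCompletion K)).injective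
  obtain ⟨-, -, hEP⟩ := Literature.NumberTheory.EllipticCurves.localEulerPoincareCharacteristic_adicCompletion K w
    (localEulerPoincareCharacteristic_adicCompletion_of_numberField w) (GaloisRep.restrictField (w.adicCompletion K) ρ)
  obtain ⟨-, h2⟩ := natCard_two_eq_natCard_invariants_homRep (w.adicCompletion K) (GaloisRep.restrictField (w.adicCompletion K) ρ) hM
  change Nat.card (galoisCohomology (GaloisRep.restrictField (w.adicCompletion K) ρ) 1) = _
  rw [← hEP]
  change _ * Nat.card (continuousCohomology 2 (GaloisRep.restrictField (w.adicCompletion K) ρ).toTopRep) * _ = _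
  rw [h2]

end Local

/-! ## §3. (P2) combined -/

section Combined

variable {K : Type u} [Field K] [NumberField K] {p k : ℕ} {M : Type u} [AddCommGroup M] [TopologicalSpace M] [DiscreteTopology M]
  [Finite M] {inv : LocalInvariants K (p ^ k)} {ρ : DiscreteGaloisModule K M} {S : Finset (Place K)} {𝓕 𝓖 : SelmerStructure ρ}
  {w₀ : HeightOneSpectrum (𝓞 K)}

/-- **(P2) `[H¹_𝓖(K, M) : H¹_𝓕(K, M)] · #loc_{w₀}(H¹_{𝓕*}(K, M^D)) · #𝓕_{w₀} = #M^{Γ_{K_{w₀}}} · #Hom_{Γ_{K_{w₀}}}(M, μ_{p^k}) · #(𝓞_{w₀} ⧸ (#M))`** —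
Poitou–Tate at one relaxed place (§1) with the local Euler–Poincaré count (§2); `M` finite killed by `p^k`, `inv` the level-`p^k` family of the
named fact `poitouTate_selmerStructure_duality K`, `𝓕 ≤ 𝓖` unramified outside `S ∋ w₀`, equal off `w₀`, `𝓖_{w₀} =` everything.
This is the (F3) identity «`#im(loc_v | 𝔖_{v̄}(K, W*)) · #loc_v(Sel^{(π^k)}(E/K)) · #N_v = 2^k · #W*[2^k](K_v) · #W[v^k](K_v)`» of
`F3-PLAN-w5g3.md` §2 before the CM dictionary (`M = W*[2^k]`, `𝓕_v = N_v`, `K_v = ℚ₂`).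
[cite: MilneADT2006, I Thm. 4.10, Thm. 2.8, Cor. 2.3] [cite: Howard2004HeegnerKolyvagin, Thm. 2.1.11 (arXiv:1202.6340 p. 6)] -/
theorem relIndex_selmerGroup_mul_natCard_map_localization_mul_natCard_eq_localEuler [Fact p.Prime] (hperf : inv.IsPerfect)
    (hvan : inv.SumLocalTermEqZero) (hcomp : inv.SelmerComplement) (hM : ∀ m : M, p ^ k • m = 0)
    (hS : ∀ v : HeightOneSpectrum (𝓞 K), (Sum.inr v : Place K) ∉ S → ((p ^ k : ℕ) : 𝓞 K) ∉ v.asIdeal ∧ GaloisRep.IsUnramifiedAt v ρ)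
    (hle : 𝓕 ≤ 𝓖) (h𝓕 : 𝓕.IsUnramifiedOutside S) (h𝓖 : 𝓖.IsUnramifiedOutside S) (hw₀ : (Sum.inr w₀ : Place K) ∈ S)
    (heq : ∀ v ≠ (Sum.inr w₀ : Place K), 𝓕 v = 𝓖 v) (htop : 𝓖 (Sum.inr w₀) = ⊤) :
    𝓕.selmerGroup.relIndex 𝓖.selmerGroup *
        Nat.card ((inv.dualSelmerStructure ρ 𝓕).selmerGroup.map
          (galoisCohomology.localization (ρ.tateDual (p ^ k)) (Sum.inr w₀ : Place K) 1)) *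
        Nat.card (𝓕 (Sum.inr w₀)) =
      Nat.card (GaloisRep.restrictField (w₀.adicCompletion K) ρ).toTopRep.ρ.invariants *
        Nat.card (ContinuousRep.homRep (GaloisRep.restrictField (w₀.adicCompletion K) ρ)
          (mu (w₀.adicCompletion K) (p ^ k))).toTopRep.ρ.invariants *
        Nat.card (w₀.adicCompletionIntegers K ⧸ Ideal.span {((Nat.card M : ℕ) : w₀.adicCompletionIntegers K)}) := by
  haveI : NeZero (p ^ k) := ⟨pow_ne_zero k (Fact.out : p.Prime).ne_zero⟩
  rw [relIndex_selmerGroup_mul_natCard_map_localization_mul_natCard_eq hperf hvan hcomp hM hS hle h𝓕 h𝓖 hw₀ heq htop]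
  exact natCard_galoisCohomology_one_toLocal_eq ρ hM w₀

end Combined

end Summit.BirchSwinnertonDyer.BirchSwinnertonDyer.Theorems.PrintCf2.RestrictedSelmerPair

end
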